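import Summits.HodgeConjecture.HodgeConjecture.Theorems.Ring2WeilCoverageCMFieldCarrierGalois
import Mathlib.GroupTheory.SpecificGroups.KleinFour
import HarnessLib

/-!
# Ring 2 — Weil-type family-coverage census, CM-field rows (X-N): the Galois groups of the four BIQUADRATIC census
# carriers are KLEIN FOUR-GROUPS — `Gal(E/ℚ) ≅ V₄` for `ℚ(ζ₈)`, `ℚ(ζ₁₂)`, `ℚ(√-3,√5)`, `ℚ(i,√5)` in the kernel

HONEST FRAMING: research route conditional on HC_CM; not a corollary; Q11.4-sentence-2 already refuted in dim ≥ 3.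

Cell `pub-hodge-ring2`, seat `ring2-b03` (gen 56), census `WEIL-FAMILY-COVERAGE.md` «## b03» b03.5, column «Galois type»
(`C₄; V₄; V₄; V₄; V₄; C₄; D₄`): parts X-L / X-M put `IsCyclic` (the two `C₄` fields), `IsGalois` + an imaginary quadratic
subfield (the four `V₄` fields) and `¬ IsGalois` (the `D₄` field) in the kernel; this file completes the `V₄` entries to
`IsKleinFour (E ≃ₐ[ℚ] E)` (Mathlib: order `4`, exponent `2`; hence not cyclic, `IsKleinFour.not_isCyclic`).

* §1 (generic, quadratic `R = S² + pS + q`, `η' ∈ E` with `η'² + η² + p = 0`): `aeval_cmRoot_cmPolyQ`; **`root_cases`** — every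
  root of `T⁴ + pT² + q` in the field `E` is one of `η, -η, η', -η'` (from the factorization `map_cmPolyQ_eq_prod` of part
  X-K); **`algEquiv_mul_self_of_involutive_twist`** — if `η' = u(η)` with `u(η') = η` AND `u(-η') = -η` (an odd twist of
  order two), every `σ ∈ Gal(E/ℚ)` satisfies `σ² = 1` (`σ(η) ∈ {±η, ±η'}` and `σ²(η) = η` in each case);
  **`isKleinFour_of_involutive_twist`** — then `Gal(E/ℚ)` is a Klein four-group (`|Gal| = [E:ℚ] = 4` by `IsGalois`,
  exponent `∣ 2` and `≠ 1`).
* §2 the four fields, with the twists of part X-M (`u = -T³ - 6T`, `-(T³ + 8T)/2`, `-(T³ + 9T)/3`, `-T³ - 3T`, as in part X-M; the identities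
  `η'² + η² + p = 0`, `u(η') = η`, `u(-η') = -η` by `linear_combination` against `η⁴ + pη² + q = 0`): `zeta8_isKleinFour`, `zeta12_isKleinFour`,
  `sqrtNeg3Sqrt5_isKleinFour`, `sqrtNeg1Sqrt5_isKleinFour` (and `…_not_isCyclic`).

THEOREMS ONLY: no `def`, no named fact, no `sorry`; `HC_CM` does not occur; nothing about the Hodge conjecture is asserted
in this file (pure Galois theory of the census carriers).

## References
* [Shimura1998] G. Shimura, *Abelian Varieties with Complex Multiplication and Modular Functions* (1998), §8 Ex. 8.4 (2)
  (quartic CM fields: biquadratic / cyclic / non-Galois). [Streng2010] M. Streng, thesis Leiden 2010, Lemma I.3.4.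
* [Deligne1982HodgeCycles] P. Deligne (notes by J. S. Milne), LNM 900 (1982), §4 (the presentation `E = ℚ(η)`).
-/

noncomputable section

set_option linter.dupNamespace false

namespace Summit.HodgeConjecture.HodgeConjecture.Ring2.WeilCoverageCM

open Polynomial NumberField
open Literature.AlgebraicGeometry.Deligne1982

/-! ## §1 Roots of `T⁴ + pT² + q` in `E` and involutive twists -/

section Generic

variable {p q : ℤ} (R : Polynomial ℤ) (hR : R = X ^ 2 + C p * X + C q) [Fact (Irreducible (cmPolyQ R))]
include hR

/-- `R(T²)(η) = 0` as an `aeval` identity (any `ℚ`-algebra structure). [cite: Deligne1982HodgeCycles, §4 p. 30] -/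
theorem aeval_cmRoot_cmPolyQ : Polynomial.aeval (cmRoot R) (cmPolyQ R) = 0 := by
  rw [Polynomial.aeval_def, eval₂_cmPolyQ_of_quadratic R hR]
  exact cmRoot_quartic R hR

/-- **The roots of `T⁴ + pT² + q` in the field `E` are `η, -η, η', -η'`** (`η'² + η² + p = 0`). [folklore] -/
theorem root_cases (t' : cmField R) (h1 : t' ^ 2 + cmRoot R ^ 2 + (p : cmField R) = 0) (x : cmField R)
    (hx : Polynomial.aeval x (cmPolyQ R) = 0) :
    x = cmRoot R ∨ x = -cmRoot R ∨ x = t' ∨ x = -t' := by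
  have hfac := map_cmPolyQ_eq_prod R hR t' h1
  have hev : Polynomial.eval x ((cmPolyQ R).map (algebraMap ℚ (cmField R))) = 0 := by
    rw [Polynomial.eval_map, ← Polynomial.aeval_def]; exact hx
  rw [hfac] at hev
  simp only [eval_mul, eval_sub, eval_add, eval_X, eval_C, mul_eq_zero] at hev
  rcases hev with (h | h) | (h | h)
  · exact Or.inl (sub_eq_zero.1 h)
  · exact Or.inr (Or.inl (eq_neg_of_add_eq_zero_left h))
  · exact Or.inr (Or.inr (Or.inl (sub_eq_zero.1 h)))
  · exact Or.inr (Or.inr (Or.inr (eq_neg_of_add_eq_zero_left h)))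

/-- **Every automorphism of `E/ℚ` is an involution** when the twist `η' = u(η)` satisfies `u(η') = η` and `u(-η') = -η`:
`σ(η) ∈ {±η, ±η'}` and `σ²(η) = η` in each of the four cases. [folklore] -/
theorem algEquiv_mul_self_of_involutive_twist (t' : cmField R) (h1 : t' ^ 2 + cmRoot R ^ 2 + (p : cmField R) = 0)
    (u : Polynomial ℚ) (hu : Polynomial.aeval (cmRoot R) u = t') (h2 : Polynomial.aeval t' u = cmRoot R)
    (h3 : Polynomial.aeval (-t') u = -cmRoot R) (σ : cmField R ≃ₐ[ℚ] cmField R) : σ * σ = 1 := by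
  have hσroot : Polynomial.aeval (σ (cmRoot R)) (cmPolyQ R) = 0 := by
    rw [Polynomial.aeval_algHom_apply, aeval_cmRoot_cmPolyQ R hR, map_zero]
  have hσt' : σ t' = Polynomial.aeval (σ (cmRoot R)) u := by
    rw [← hu, ← Polynomial.aeval_algHom_apply]
  have key : σ (σ (cmRoot R)) = cmRoot R := by
    rcases root_cases R hR t' h1 _ hσroot with h | h | h | h
    · rw [h, h]
    · rw [h, map_neg, h, neg_neg]
    · rw [h, hσt', h, h2]
    · rw [h, map_neg, hσt', h, h3, neg_neg]
  have hring : ((σ * σ : cmField R ≃ₐ[ℚ] cmField R) : cmField R →+* cmField R) =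
      ((1 : cmField R ≃ₐ[ℚ] cmField R) : cmField R →+* cmField R) :=
    ringHom_ext_cmRoot R (by simpa using key)
  ext x
  exact RingHom.congr_fun hring x

/-- **`Gal(E/ℚ)` is a KLEIN FOUR-GROUP** when `η'² + η² + p = 0` for an involutive odd twist `η' = u(η)` (`u(η') = η`,
`u(-η') = -η`): `|Gal(E/ℚ)| = [E:ℚ] = 4` (Galois, part X-K) and every element squares to `1`.
[cite: Shimura1998, §8 Ex. 8.4 (2)] -/
theorem isKleinFour_of_involutive_twist (t' : cmField R) (h1 : t' ^ 2 + cmRoot R ^ 2 + (p : cmField R) = 0)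
    (u : Polynomial ℚ) (hu : Polynomial.aeval (cmRoot R) u = t') (h2 : Polynomial.aeval t' u = cmRoot R)
    (h3 : Polynomial.aeval (-t') u = -cmRoot R) : IsKleinFour (cmField R ≃ₐ[ℚ] cmField R) := by
  haveI : IsGalois ℚ (cmField R) := isGalois_of_sq_add R hR t' h1
  have hcard : Nat.card (cmField R ≃ₐ[ℚ] cmField R) = 4 := by
    have hdeg : R.natDegree = 2 := by rw [hR]; compute_degree!
    rw [IsGalois.card_aut_eq_finrank, finrank_cmField, hdeg]
  refine ⟨hcard, ?_⟩
  have hdvd : Monoid.exponent (cmField R ≃ₐ[ℚ] cmField R) ∣ 2 :=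
    Monoid.exponent_dvd_iff_forall_pow_eq_one.2 fun σ => by
      rw [sq]; exact algEquiv_mul_self_of_involutive_twist R hR t' h1 u hu h2 h3 σ
  rcases (Nat.dvd_prime Nat.prime_two).1 hdvd with h | h
  · exfalso
    have hsub := Monoid.exp_eq_one_iff.1 h
    have h1 : Nat.card (cmField R ≃ₐ[ℚ] cmField R) = 1 := Nat.card_eq_one_iff_unique.2 ⟨hsub, ⟨1⟩⟩
    omega
  · exact h

end Generic

/-! ## §2 The four biquadratic census fields -/

section Zeta8

variable {R : Polynomial ℤ} (hR : R = X ^ 2 + C 6 * X + C 1)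
include hR

/-- **`Gal(ℚ(ζ₈)/ℚ) ≅ V₄`** (`η = i(1+√2)`, `η' = -η³ - 6η = η⁻¹`, `u = -T³ - 6T` involutive and odd). [folklore] -/
theorem zeta8_isKleinFour [Fact (Irreducible (cmPolyQ R))] : IsKleinFour (cmField R ≃ₐ[ℚ] cmField R) := by
  have ht := cmRoot_quartic R hR
  push_cast at ht
  refine isKleinFour_of_involutive_twist R hR (-cmRoot R ^ 3 - 6 * cmRoot R)
    (by push_cast; linear_combination (cmRoot R ^ 2 + 6) * ht) (-X ^ 3 - 6 * X) ?_ ?_ ?_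
  · simp only [map_sub, map_neg, map_mul, map_pow, aeval_X, map_ofNat]
  · simp only [map_sub, map_neg, map_mul, map_pow, aeval_X, map_ofNat]
    linear_combination (cmRoot R ^ 5 + 12 * cmRoot R ^ 3 + 35 * cmRoot R) * ht
  · simp only [map_sub, map_neg, map_mul, map_pow, aeval_X, map_ofNat]
    linear_combination (-(cmRoot R ^ 5) - 12 * cmRoot R ^ 3 - 35 * cmRoot R) * ht

/-- `Gal(ℚ(ζ₈)/ℚ)` is not cyclic. [folklore] -/
theorem zeta8_not_isCyclic [Fact (Irreducible (cmPolyQ R))] : ¬ IsCyclic (cmField R ≃ₐ[ℚ] cmField R) :=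
  haveI := zeta8_isKleinFour hR
  IsKleinFour.not_isCyclic

end Zeta8

section Zeta12

variable {R : Polynomial ℤ} (hR : R = X ^ 2 + C 8 * X + C 4)
include hR

/-- **`Gal(ℚ(ζ₁₂)/ℚ) ≅ V₄`** (`η = i(1+√3)`, `η' = -(η³ + 8η)/2 = 2η⁻¹`, `u = -(T³ + 8T)/2`). [folklore] -/
theorem zeta12_isKleinFour [Fact (Irreducible (cmPolyQ R))] : IsKleinFour (cmField R ≃ₐ[ℚ] cmField R) := by
  have ht := cmRoot_quartic R hR
  push_cast at ht
  refine isKleinFour_of_involutive_twist R hR (-(cmRoot R ^ 3 + 8 * cmRoot R) / 2)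
    (by push_cast; linear_combination (cmRoot R ^ 2 / 4 + 2) * ht) (-(X ^ 3 + 8 * X) * C (1 / 2 : ℚ)) ?_ ?_ ?_
  · simp only [map_mul, map_neg, map_add, map_pow, aeval_X, aeval_C, map_ofNat, map_div₀, map_one]
    ring
  · simp only [map_mul, map_neg, map_add, map_pow, aeval_X, aeval_C, map_ofNat, map_div₀, map_one]
    linear_combination (cmRoot R ^ 5 / 16 + cmRoot R ^ 3 + 15 / 4 * cmRoot R) * ht
  · simp only [map_mul, map_neg, map_add, map_pow, aeval_X, aeval_C, map_ofNat, map_div₀, map_one]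
    linear_combination (-(cmRoot R ^ 5) / 16 - cmRoot R ^ 3 - 15 / 4 * cmRoot R) * ht

/-- `Gal(ℚ(ζ₁₂)/ℚ)` is not cyclic. [folklore] -/
theorem zeta12_not_isCyclic [Fact (Irreducible (cmPolyQ R))] : ¬ IsCyclic (cmField R ≃ₐ[ℚ] cmField R) :=
  haveI := zeta12_isKleinFour hR
  IsKleinFour.not_isCyclic

end Zeta12

section SqrtNeg3Sqrt5

variable {R : Polynomial ℤ} (hR : R = X ^ 2 + C 9 * X + C 9)
include hR

/-- **`Gal(ℚ(√-3,√5)/ℚ) ≅ V₄`** (`η = √-3(1+√5)/2`, `η' = -(η³ + 9η)/3 = 3η⁻¹`, `u = -(T³ + 9T)/3`). [folklore] -/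
theorem sqrtNeg3Sqrt5_isKleinFour [Fact (Irreducible (cmPolyQ R))] : IsKleinFour (cmField R ≃ₐ[ℚ] cmField R) := by
  have ht := cmRoot_quartic R hR
  push_cast at ht
  refine isKleinFour_of_involutive_twist R hR (-(cmRoot R ^ 3 + 9 * cmRoot R) / 3)
    (by push_cast; linear_combination (cmRoot R ^ 2 / 9 + 1) * ht) (-(X ^ 3 + 9 * X) * C (1 / 3 : ℚ)) ?_ ?_ ?_
  · simp only [map_mul, map_neg, map_add, map_pow, aeval_X, aeval_C, map_ofNat, map_div₀, map_one]
    ring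
  · simp only [map_mul, map_neg, map_add, map_pow, aeval_X, aeval_C, map_ofNat, map_div₀, map_one]
    linear_combination (cmRoot R ^ 5 / 81 + 2 / 9 * cmRoot R ^ 3 + 8 / 9 * cmRoot R) * ht
  · simp only [map_mul, map_neg, map_add, map_pow, aeval_X, aeval_C, map_ofNat, map_div₀, map_one]
    linear_combination (-(cmRoot R ^ 5) / 81 - 2 / 9 * cmRoot R ^ 3 - 8 / 9 * cmRoot R) * ht

/-- `Gal(ℚ(√-3,√5)/ℚ)` is not cyclic. [folklore] -/
theorem sqrtNeg3Sqrt5_not_isCyclic [Fact (Irreducible (cmPolyQ R))] : ¬ IsCyclic (cmField R ≃ₐ[ℚ] cmField R) :=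
  haveI := sqrtNeg3Sqrt5_isKleinFour hR
  IsKleinFour.not_isCyclic

end SqrtNeg3Sqrt5

section SqrtNeg1Sqrt5

variable {R : Polynomial ℤ} (hR : R = X ^ 2 + C 3 * X + C 1)
include hR

/-- **`Gal(ℚ(i,√5)/ℚ) ≅ V₄`** (`η = i(1+√5)/2`, `η' = -η³ - 3η = η⁻¹`, `u = -T³ - 3T`). [folklore] -/
theorem sqrtNeg1Sqrt5_isKleinFour [Fact (Irreducible (cmPolyQ R))] : IsKleinFour (cmField R ≃ₐ[ℚ] cmField R) := by
  have ht := cmRoot_quartic R hR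
  push_cast at ht
  refine isKleinFour_of_involutive_twist R hR (-cmRoot R ^ 3 - 3 * cmRoot R)
    (by push_cast; linear_combination (cmRoot R ^ 2 + 3) * ht) (-X ^ 3 - 3 * X) ?_ ?_ ?_
  · simp only [map_sub, map_neg, map_mul, map_pow, aeval_X, map_ofNat]
  · simp only [map_sub, map_neg, map_mul, map_pow, aeval_X, map_ofNat]
    linear_combination (cmRoot R ^ 5 + 6 * cmRoot R ^ 3 + 8 * cmRoot R) * ht
  · simp only [map_sub, map_neg, map_mul, map_pow, aeval_X, map_ofNat]
    linear_combination (-(cmRoot R ^ 5) - 6 * cmRoot R ^ 3 - 8 * cmRoot R) * ht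

/-- `Gal(ℚ(i,√5)/ℚ)` is not cyclic. [folklore] -/
theorem sqrtNeg1Sqrt5_not_isCyclic [Fact (Irreducible (cmPolyQ R))] : ¬ IsCyclic (cmField R ≃ₐ[ℚ] cmField R) :=
  haveI := sqrtNeg1Sqrt5_isKleinFour hR
  IsKleinFour.not_isCyclic

end SqrtNeg1Sqrt5

end Summit.HodgeConjecture.HodgeConjecture.Ring2.WeilCoverageCM

end
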